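import Summits.HodgeConjecture.HodgeConjecture.Theorems.F0P6aStubFROBRoofGeoWiringHoleDischargers
import HarnessLib

/-!
# `F0P6aStubFROBRoofGeoWiring` — ★ RE-HOME of `Lines/F0_P6a_StubFROBRoofGeoWiring.lean` (tree sha16 46cdc102588d6598), PART 4 of 4 — tree lines :903–:1102 (LAST part: the module the `Lines/` shim and consumers import; it transitively carries parts 1–3).

See PART 1 `Theorems/F0P6aStubFROBRoofGeoWiringWiring.lean` for the full ★ re-home header and the original module docstring (verbatim there).  Same namespace (every fully-qualified name unchanged);
the scopes open at the cut (`noncomputable section` ∕ `namespace` ∕ `section`s) are re-opened below with their `variable` ∕ `open` ∕ `set_option` ∕ `omit` ∕ `include` ∕ `universe` lines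
replayed verbatim from the tree, in order; the code after the replay block is the tree bytes :903–:1102, untouched.  HC_CM is proved only modulo the 7 printed citations (2 remaining: hLiu418 = stmt-HodgeConjecture-24832, h413 = stmt-HodgeConjecture-24833) until rung 0 closes; a re-home is count-neutral.
-/

-- ── replay of the scopes open at tree line :903 (verbatim) ──
set_option autoImplicit false
set_option linter.dupNamespace false
set_option linter.unusedSectionVars false
noncomputable section
namespace Summit.HodgeConjecture.HodgeConjecture.Cruxes.HLiu418.F0P6aStubFROBRoofGeoWiring
open CategoryTheory CategoryTheory.Limits NumberField IsDedekindDomain MulAction AlgebraicGeometry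
open scoped Matrix Pointwise MonoidalCategory MonObj CategoryTheory.Obj Polynomial
open Literature.NumberTheory.GaloisRepresentations
open Literature.NumberTheory.Automorphic Literature.NumberTheory.Automorphic.UnitaryGroup
open Literature.AlgebraicGeometry.ShimuraVarieties.UnitaryCanonicalModel
open Literature.NumberTheory.Automorphic.Liu2021.AppendixC
open Literature.AlgebraicGeometry.Motives (AlgPoints IntegralModel SchemeOver thickening thickeningLift specOver relFrobeniusOver frobeniusTwistOver frobSpec)
open Literature.NumberTheory.DiophantineGeometry (geomResidueField specialFibreFunctor specResidueField)
open Literature.AlgebraicGeometry.RelativeSpec (ActionOver)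
open Literature.AlgebraicGeometry.GroupSchemes Literature.AlgebraicGeometry.GroupSchemes.GroupSchemeKernel
open Literature.AlgebraicGeometry.GroupSchemes.AffineGroupScheme (Alg quotIncl)
open Literature.AlgebraicGeometry.AbelianSchemes Literature.AlgebraicGeometry.AbelianSchemes.AbelianSchemeOver
open Summit.HodgeConjecture.HodgeConjecture.Cruxes.HLiu418.F0P6aModuliDatumDefs
open Summit.HodgeConjecture.HodgeConjecture.Cruxes.HLiu418.F0P6aRGDAssembly
open Summit.HodgeConjecture.HodgeConjecture.Cruxes.HLiu418.F0P6aDatumOfInputs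
open Summit.HodgeConjecture.HodgeConjecture.Cruxes.HLiu418.F0P6aLineSpecialisation (spGeoOf)
open Summit.HodgeConjecture.HodgeConjecture.Cruxes.HLiu418.F0P6aRoofCwKernel (hsat_sch₀Of)
open Summit.HodgeConjecture.HodgeConjecture.Cruxes.HLiu418.F0P6aStubFROBRoofGeo
variable {F : Type} [Field F] [NumberField F] [IsCMField F] [IsGalois ℚ F] {ι₁ : F →+* ℂ}
    {Jstar : Matrix (Fin 2) (Fin 2) F}
    {K₀ : C5.OpenCompactSubgroup ↥(finAdelic ↥(maximalRealSubfield F) F (IsCMField.complexConj F) 2 Jstar)}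
    {S : RecordSystemGS F Jstar ι₁ K₀} {hU7ₛ : S.HeckeTranslateDefinedOver}
    {hJ : (Jstar.map (IsCMField.complexConj F))ᵀ = Jstar} {hJu : IsUnit Jstar}
    {Fi : Type} [Field Fi] [Algebra F Fi] {Kc : C5.SmallLevel K₀} {G : Type} [Group G]
    {𝓜 : IntegralModel (𝓞 F) F ((thickening F Fi).obj (S.M.obj Kc))}
    {w : HeightOneSpectrum (𝓞 F)} {hw : (IsCMField.complexConj F) • w ≠ w} {h𝓨 : (𝓜.localise w).IsSmoothProper 1}
    {θ : ActionOver (𝓜.localise w).total.hom ((Fi ≃ₐ[F] Fi) × G)}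
    {e : Fi →ₐ[F] AlgebraicClosure (w.adicCompletion F)}
open Summit.HodgeConjecture.HodgeConjecture.Cruxes.HLiu418.F0P6aLineSpecialisation
  (LineWOf lineWOfKernel lineWOfKernel_le mem_lineWOfKernel_iff natCard_roofKernel_eq roofKernel_stable natCard_roofKernel_inf_idealTorsionΩ_w_eq)
open Literature.NumberTheory.EllipticCurves (genericFibre specGenericPoint)
open Summit.HodgeConjecture.HodgeConjecture.Cruxes.HLiu418.F0P6aStubFROBRoofLegs (roofLegs_of_roofLink_kerRows)
open Literature.AlgebraicGeometry.Motives (extendPoint specValuationSubring specFractionFieldι specRingHomι)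
open Literature.NumberTheory.DiophantineGeometry (toClosureValuationSubring geomClosedPointIsoSpecResidueField)
open Literature.NumberTheory.EllipticCurves (genericFibre specGenericPoint)
open Summit.HodgeConjecture.HodgeConjecture.Cruxes.HLiu418.F0P6aLineSpecialisation (isIdealTorsionΩ_mul_of_roofLink natCard_roofKernel_eq)
section KillWitness
open Literature.AlgebraicGeometry.Motives (extendPoint specValuationSubring specFractionFieldι specRingHomι)
open Literature.NumberTheory.DiophantineGeometry (geomClosedPointIsoSpecResidueField geomResidueFieldEquiv toClosureValuationSubring)
open Literature.NumberTheory.EllipticCurves (genericFibre specGenericPoint)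
open Summit.HodgeConjecture.HodgeConjecture.Cruxes.HLiu418.F0P6aLineSpecialisation
  (isoGenericOf isoSpecialOf liftOf sΩ sκ left_thickeningLift_comp_genericι_eq left_red₀Of_comp_specialι_eq
   quotIncl_spGeoOf_comp_eq_one_of_kerRow exists_wWitness_of_kerRow)
-- ── tree bytes :903–:1102 ──

set_option backward.isDefEq.respectTransparency false in  -- the (K3₀) row's `= 1` over `(Over.pullback _).obj 𝒦`
set_option synthInstance.maxHeartbeats 100000 in
set_option maxHeartbeats 400000 in
/-- **(W) `HoleCLW` FROM THE §A BLOCK** — the `w`-side witness for every `(y, L)`: `RoofΩ` re-packed from the block's sixteen components, `H_w := K ∩ A_y[𝔭_w]` as a `w`-line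
(§R `exists_lineWOf_of_roof` over (RKC)), then (KEW) HEAD-W `exists_wWitness_of_kerRow` with the (K3₀) row and `hσ` (target abelian scheme named in the `sch₀Of` spelling).
[cite: Liu2021, Appendix D, Prop. D.8 (3) (p. 137)] [cite: Tate1997FiniteFlatGroupSchemes, (3.7)] -/
theorem holeCLW_of_blk
    (I : RGDInputsAt F ι₁ Jstar K₀ S hU7ₛ hJ hJu Fi Kc G 𝓜 w hw h𝓨 θ e) [ExpChar (geomResidueField w) I.pChar]
    (quotΩ : ∀ y, LineOf I y → AlgPoints (S.M.obj Kc) (AlgebraicClosure (w.adicCompletion F)))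
    (translΩ : AlgPoints (S.M.obj Kc) (AlgebraicClosure (w.adicCompletion F)) → AlgPoints (S.M.obj Kc) (AlgebraicClosure (w.adicCompletion F)))
    (hhecke : HeckeClause I quotΩ translΩ)
    (hunit : (UnitaryGroup.isUnit_placeForm Jstar hJu w).unit ∈ glInt 2 (w.adicCompletion F))
    (hKc : UnitaryGroup.IsHyperspecialAt ↥(maximalRealSubfield F) F (IsCMField.complexConj F) 2 Jstar Kc.1.1 (w.under (𝓞 ↥(maximalRealSubfield F))))
    (hroof : RoofLink I quotΩ) (hroof₂ : RoofLink₂ I translΩ)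
    {m : ℕ} (E' : Matrix (Fin m) (Fin m) (𝓞 F)) (hE' : E' * E' = E')
    (qbarOf : QbarTy I quotΩ E' hE') (hmono : HoleMono I quotΩ E' hE' qbarOf)
    (hblk :
      haveI := I.comm
      haveI : IsProper (𝓜.localise w).total.hom := h𝓨.2
        ∀ (y : AlgPoints (S.M.obj Kc) (AlgebraicClosure (w.adicCompletion F))) (L : LineOf I y),
          haveI := hmono y L
          ∃ K : Subgroup ((fibreΩOf S Kc 𝓜 w e I.univ y).Points (AlgebraicClosure (w.adicCompletion F))),
          (∀ P, P ∈ L.1 ↔ P ∈ K ∧ IsIdealTorsionΩ S Kc 𝓜 w e I.univ I.act y ((IsCMField.complexConj F) • w).asIdeal P) ∧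
          ∃ (B : Literature.AlgebraicGeometry.AbelianSchemes.AbelianSchemeOver (AlgebraicGeometry.Spec (CommRingCat.of (AlgebraicClosure (w.adicCompletion F)))))
            (DB : B.DualPair) (lamB : B.X ⟶ DB.hat.X) (_ : IsMonHom lamB)
            -- J12 INTERFACE PIN (ref1 (g2) e-12): `B̂`'s Poincaré sheaf is normalised along `A × {ε_B̂}` — the unit clause `hD_B` (for a ★ `Polarization` it is ★ `Polarization.nonempty_unitHatSlice_iso`)
            (_ : Nonempty ((AlgebraicGeometry.Scheme.Modules.pullback DB.unitHatSlice).obj DB.P ≅ SheafOfModules.unit _))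
            (q : (schΩOf S Kc 𝓜 w e I.univ y).X ⟶ B.X) (_ : IsMonHom q)
            (c : (schΩOf S Kc 𝓜 w e I.univ (quotΩ y L)).X ⟶ B.X) (_ : IsMonHom c),
            -- (r1) kernel of `q` on `Ω`-points
            (∀ P : (fibreΩOf S Kc 𝓜 w e I.univ y).Points (AlgebraicClosure (w.adicCompletion F)),
                (AlgPoints.map q P : B.toAffine.toAbelianVariety.Points (AlgebraicClosure (w.adicCompletion F))) = 1 ↔ P ∈ K) ∧
            -- (r2) kernel of `c` on `Ω`-points = the `𝔞`-torsion; `c` surjective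
            (∀ P : (fibreΩOf S Kc 𝓜 w e I.univ (quotΩ y L)).Points (AlgebraicClosure (w.adicCompletion F)),
                (AlgPoints.map c P : B.toAffine.toAbelianVariety.Points (AlgebraicClosure (w.adicCompletion F))) = 1 ↔
                  IsIdealTorsionΩ S Kc 𝓜 w e I.univ I.act (quotΩ y L) w.asIdeal P) ∧
            Function.Surjective c.left.base ∧
            -- (r3) polarisations: `q^* λ_B = p • λ_y`, `c^* λ_B = p • λ_y″`
            q ≫ lamB ≫ Literature.AlgebraicGeometry.AbelianSchemes.AbelianSchemeOver.DualPair.dualIsogenyOver q (dualΩOf S Kc 𝓜 w e I.univ I.dual y) DB =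
              (polΩOf S Kc 𝓜 w e I.univ I.pol y).lam ≫ (dualΩOf S Kc 𝓜 w e I.univ I.dual y).hat.mulN I.pChar ∧
            c ≫ lamB ≫ Literature.AlgebraicGeometry.AbelianSchemes.AbelianSchemeOver.DualPair.dualIsogenyOver c (dualΩOf S Kc 𝓜 w e I.univ I.dual (quotΩ y L)) DB =
              (polΩOf S Kc 𝓜 w e I.univ I.pol (quotΩ y L)).lam ≫ (dualΩOf S Kc 𝓜 w e I.univ I.dual (quotΩ y L)).hat.mulN I.pChar ∧
            -- (r4) `𝒪_F`-equivariance through a common endomorphism of `B`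
            (∀ a : 𝓞 F, ∃ b : B.X ⟶ B.X,
                (actΩOf S Kc 𝓜 w e I.univ I.act a y).hom.hom.hom ≫ q = q ≫ b ∧ (actΩOf S Kc 𝓜 w e I.univ I.act a (quotΩ y L)).hom.hom.hom ≫ c = c ≫ b) ∧
            -- (r5) level-`N` points correspond
            (∀ a : Fin I.g ⊕ Fin I.g → ZMod I.N,
                (AlgPoints.map q (lvlPtΩOf S Kc 𝓜 w e I.univ I.lvl y a) : B.toAffine.toAbelianVariety.Points (AlgebraicClosure (w.adicCompletion F))) =
                  AlgPoints.map c (lvlPtΩOf S Kc 𝓜 w e I.univ I.lvl (quotΩ y L) a)) ∧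
              -- (K3₀) model KILL along a flat `𝒦 ↪ I.univ_ỹ` over `R = 𝒪_Ω̄` (`ỹ := extendPoint … (ℓ_e y)` the `R`-point extending `y` = LS `liftOf`): if `𝒦_η`, read in `A_y` through ★ (d5)'s three-piece
              -- isomorphism (= LS `isoGenericOf` by `hσΩ`), is killed by the LEG `q`, then `𝒦_s`, read in `sch₀Of … (red₀ y)` (= LS `isoSpecialOf` by `hσκ`), is killed by `q̄` — EXACTLY (KEW) `…_of_kerRow`'s `hK3`
              (∀ (𝒦 : Over (Spec (.of (closureValuationSubring (w.adicCompletion F))))) (incl : 𝒦 ⟶ (I.univ.baseChange (extendPoint (closureValuationSubring (w.adicCompletion F)) (toClosureValuationSubring w) (𝓜.localise w).total ((𝓜.localise w).modelPointsEquiv.symm (thickeningLift e (S.M.obj Kc) y))).left).X) [Flat 𝒦.hom],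
                ((Over.pullback (specFractionFieldι (closureValuationSubring (w.adicCompletion F)) (toClosureValuationSubring w)).left).map incl ≫
                    (I.univ.fibreBaseChangeIso ((𝓜.localise w).genericIso'.inv.left ≫ pullback.fst (𝓜.localise w).total.hom (specGenericPoint (HeightOneSpectrum.valuationSubringAtPrime F w) F)) (thickeningLift e (S.M.obj Kc) y).left ≪≫ I.univ.fibreCongrPtIso ((𝓜.localise w).left_specFractionFieldι_comp_extendPoint_modelPointsEquiv_symm (thickeningLift e (S.M.obj Kc) y)).symm ≪≫ (I.univ.fibreBaseChangeIso (extendPoint (closureValuationSubring (w.adicCompletion F)) (toClosureValuationSubring w) (𝓜.localise w).total ((𝓜.localise w).modelPointsEquiv.symm (thickeningLift e (S.M.obj Kc) y))).left (specFractionFieldι (closureValuationSubring (w.adicCompletion F)) (toClosureValuationSubring w)).left).symm).inv.hom.hom.hom) ≫ q = 1 →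
                ((Over.pullback ((geomClosedPointIsoSpecResidueField w).inv.left ≫ (specRingHomι (closureValuationSubring (w.adicCompletion F)) (toClosureValuationSubring w) (IsLocalRing.residue (closureValuationSubring (w.adicCompletion F)))).left)).map incl ≫
                    (I.univ.fibreBaseChangeIso (pullback.fst (𝓜.localise w).total.hom (specResidueField w)) ((𝓜.localise w).geomReductionMap (thickeningLift e (S.M.obj Kc) y)).left ≪≫ I.univ.fibreCongrPtIso (((𝓜.localise w).left_geomReductionMap_comp_fst (thickeningLift e (S.M.obj Kc) y)).trans (Category.assoc _ _ _).symm) ≪≫ (I.univ.fibreBaseChangeIso (extendPoint (closureValuationSubring (w.adicCompletion F)) (toClosureValuationSubring w) (𝓜.localise w).total ((𝓜.localise w).modelPointsEquiv.symm (thickeningLift e (S.M.obj Kc) y))).left ((geomClosedPointIsoSpecResidueField w).inv.left ≫ (specRingHomι (closureValuationSubring (w.adicCompletion F)) (toClosureValuationSubring w) (IsLocalRing.residue (closureValuationSubring (w.adicCompletion F)))).left)).symm).inv.hom.hom.hom) ≫ qbarOf y L = 1) ∧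
              -- (K2₀) for every ideal `𝔞`: `Ker q(Ω̄) ⊆ A_y[𝔞](Ω̄)` on points ⇒ `Ker q̄ ⊆ A_{red₀ y}[𝔞]` on ALL `T`-points (★ currency; `IsIdealTorsionΩ … y 𝔞 Pt` and
              -- `(act₀Of 𝓜 w I.univ I.act r (red₀Of … y)).hom.hom.hom` unfold to the two `.i r` terms by `actΩOf_hom_hom_hom` ∕ `act₀Of_hom_hom_hom` (rfl)); at `𝔞 := 𝔭_w·𝔭_{c•w}` = W3∕W5's `hker`
              (∀ 𝔞 : Ideal (𝓞 F),
                (∀ Pt : ((I.univ.baseChange ((𝓜.localise w).genericIso'.inv.left ≫ pullback.fst (𝓜.localise w).total.hom (specGenericPoint (HeightOneSpectrum.valuationSubringAtPrime F w) F))).baseChange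
                    (thickeningLift e (S.M.obj Kc) y).left).toAffine.toAbelianVariety.Points (AlgebraicClosure (w.adicCompletion F)),
                  (AlgPoints.map q Pt : B.toAffine.toAbelianVariety.Points (AlgebraicClosure (w.adicCompletion F))) = 1 →
                    ∀ r ∈ 𝔞, (AlgPoints.map (((I.act.baseChange ((𝓜.localise w).genericIso'.inv.left ≫ pullback.fst (𝓜.localise w).total.hom (specGenericPoint (HeightOneSpectrum.valuationSubringAtPrime F w) F))).baseChange (thickeningLift e (S.M.obj Kc) y).left).i r) Pt :
                      ((I.univ.baseChange ((𝓜.localise w).genericIso'.inv.left ≫ pullback.fst (𝓜.localise w).total.hom (specGenericPoint (HeightOneSpectrum.valuationSubringAtPrime F w) F))).baseChange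
                        (thickeningLift e (S.M.obj Kc) y).left).toAffine.toAbelianVariety.Points (AlgebraicClosure (w.adicCompletion F))) = 1) →
                ∀ ⦃T : SchemeOver (geomResidueField w)⦄ (z : T ⟶ (sch₀Of 𝓜 w I.univ (red₀Of S Kc 𝓜 w h𝓨 e y)).X),
                  z ≫ qbarOf y L = 1 → ∀ r ∈ 𝔞, z ≫ (act₀Of 𝓜 w I.univ I.act r (red₀Of S Kc 𝓜 w h𝓨 e y)).hom.hom.hom = 1) ∧
              -- (K4₀) degree, (FIN₀) finiteness, (RK₀) `rk Γ(Ker q̄) = #Ker q(Ω̄)` of the reduced leg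
              Literature.AlgebraicGeometry.Motives.AbelianVariety.Hom.kerRank (homOfIsMonHom (qbarOf y L)) = Literature.AlgebraicGeometry.Motives.AbelianVariety.Hom.kerRank (homOfIsMonHom q) ∧
              IsFinite (qbarOf y L).left ∧
              Module.finrank (geomResidueField w) (Literature.AlgebraicGeometry.GroupSchemes.AffineGroupScheme.Alg (Literature.AlgebraicGeometry.GroupSchemes.GroupSchemeKernel.ker (qbarOf y L))) =
                Nat.card (Literature.AlgebraicGeometry.Motives.AbelianVariety.Hom.kerPoints (specOver (AlgebraicClosure (w.adicCompletion F)) (AlgebraicClosure (w.adicCompletion F))) (homOfIsMonHom q)))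
    (hσ : ∀ y : AlgPoints (S.M.obj Kc) (AlgebraicClosure (w.adicCompletion F)),
      (isoGenericOf I y).inv =
        (I.univ.fibreBaseChangeIso ((𝓜.localise w).genericIso'.inv.left ≫ pullback.fst (𝓜.localise w).total.hom (specGenericPoint (HeightOneSpectrum.valuationSubringAtPrime F w) F))
            (thickeningLift e (S.M.obj Kc) y).left ≪≫
          I.univ.fibreCongrPtIso (left_thickeningLift_comp_genericι_eq S Kc 𝓜 w h𝓨 e y) ≪≫
          (I.univ.fibreBaseChangeIso (liftOf S Kc 𝓜 w h𝓨 e y).left (sΩ w)).symm).inv.hom.hom.hom ∧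
      (isoSpecialOf I y).inv =
        (I.univ.fibreBaseChangeIso (pullback.fst (𝓜.localise w).total.hom (specResidueField w)) (red₀Of S Kc 𝓜 w h𝓨 e y).left ≪≫
          I.univ.fibreCongrPtIso (left_red₀Of_comp_specialι_eq S Kc 𝓜 w h𝓨 e y) ≪≫
          (I.univ.fibreBaseChangeIso (liftOf S Kc 𝓜 w h𝓨 e y).left (sκ w)).symm).inv.hom.hom.hom)
 :
    HoleCLW I quotΩ E' hE' qbarOf := by
  haveI := I.comm
  haveI : IsProper (𝓜.localise w).total.hom := h𝓨.2
  intro y L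
  haveI := hmono y L
  have hb := hblk y L
  obtain ⟨K, hK, B, DB, lamB, iL, hDB, q, iq, c, ic, h1, h2, hsj, h3q, h3c, h4, h5, hK3, -, -, -, -⟩ := hb
  haveI := iq
  have hW := exists_lineWOf_of_roof I quotΩ translΩ hhecke hunit hKc hroof hroof₂ I.hunr y L K
    ⟨hK, B, DB, lamB, iL, hDB, q, iq, c, ic, h1, h2, hsj, h3q, h3c, h4, h5⟩
  obtain ⟨Hw, hHK, -⟩ := hW
  have hc := exists_wWitness_of_kerRow I y Hw q K hHK h1
    (Bbar := sch₀Of 𝓜 w (serreTensor I.act E' hE') (red₀Of S Kc 𝓜 w h𝓨 e (quotΩ y L))) (qbarOf y L) (hσ y).1 (hσ y).2 hK3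
  exact hc

end KillWitness

/-! ## HEAD″ — `roofgeo_closed_of_sigma`: ZERO HOLES but the (F1) identifications `hσΩ hσκ` (RULE 40; paid by the leaf on LS ED. 3, RULE 41) -/

section HeadClosed

open Literature.AlgebraicGeometry.Motives (extendPoint specValuationSubring specFractionFieldι specRingHomι)
open Literature.NumberTheory.DiophantineGeometry (geomClosedPointIsoSpecResidueField geomResidueFieldEquiv toClosureValuationSubring)
open Literature.NumberTheory.EllipticCurves (genericFibre specGenericPoint)
open Summit.HodgeConjecture.HodgeConjecture.Cruxes.HLiu418.F0P6aLineSpecialisation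
  (isoGenericOf isoSpecialOf liftOf sΩ sκ left_thickeningLift_comp_genericι_eq left_red₀Of_comp_specialι_eq)

set_option maxHeartbeats 400000 in
set_option synthInstance.maxHeartbeats 100000 in
/-- **W5b HEAD″ `roofgeo_closed_of_sigma`** — `Quot₀RoofLaw I 𝔡 quotΩ (spGeoOf I 𝔡) frobIdeal` from the SOCKET's binders + `(frobIdeal) (hfrob)` + the (F1) identifications
`hσ : ∀ y, (isoGenericOf I y).inv = three-piece ∧ (isoSpecialOf I y).inv = three-piece` ((KE)∕(KEW)'s `hσΩ hσκ` binders; `rfl`-dischargeable on LS ED. 3 only).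
INSIDE: the Serre presentation of `𝔭_w⁻¹` with scalar `p` (★ `exists_serrePresentation_of_ideal_of_natCast_mem`), the unit pin `hD` (★ `Polarization.nonempty_unitHatSlice_iso` on the
reduced localised model, LA6-p01 (g3) HDPin), W1-a head′ `roofLegs_of_roofLink_kerRows` SKOLEMISED by `choose` (`qbarOf` + the sixteen roof components + the nine rows), the
roof `RoofΩ` re-packed (§R `roofΩ_of_rows`), `HoleMiddle` ← W1-b `exists_roofMiddleDual₀'`, `HoleKer` ← (K2₀) ∘ (RKC) `isIdealTorsionΩ_mul_of_roofLink`, `HoleFin` ← (FIN₀),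
`HoleRkK` ← (RK₀) ∘ §R `eq_mul_self_of_rkRow`, `HoleKill` ← (KE) HEAD-K ∘ (K3₀), `HoleCLW` ← (KEW) HEAD-W ∘ §R `exists_lineWOf_of_roof` ∘ (K3₀), `hunr := I.hunr`; then HEAD′.
[cite: Liu2021, Prop. D.8 (3) p. 135, pp. 136–138] [cite: RapoportSmithlingZhang2020Diagonal, §4.3 (4.23) p. 21] [cite: Kottwitz1992, §5 (p. 391)] -/
theorem roofgeo_closed_of_sigma (I : RGDInputsAt F ι₁ Jstar K₀ S hU7ₛ hJ hJu Fi Kc G 𝓜 w hw h𝓨 θ e) [ExpChar (geomResidueField w) I.pChar]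
    (𝔡 : ∀ xbar, DockAt I xbar)
    (quotΩ : ∀ y, LineOf I y → AlgPoints (S.M.obj Kc) (AlgebraicClosure (w.adicCompletion F)))
    (translΩ : AlgPoints (S.M.obj Kc) (AlgebraicClosure (w.adicCompletion F)) → AlgPoints (S.M.obj Kc) (AlgebraicClosure (w.adicCompletion F)))
    (_hhecke : HeckeClause I quotΩ translΩ) (_hroof : RoofLink I quotΩ) (_hroof₂ : RoofLink₂ I translΩ)
    (_hunit : (UnitaryGroup.isUnit_placeForm Jstar hJu w).unit ∈ glInt 2 (w.adicCompletion F))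
    (_hKc : UnitaryGroup.IsHyperspecialAt ↥(maximalRealSubfield F) F (IsCMField.complexConj F) 2 Jstar Kc.1.1
      (w.under (𝓞 ↥(maximalRealSubfield F))))
    (_hdisj : haveI : AlgebraicGeometry.IsProper (𝓜.localise w).total.hom := h𝓨.2
      ∀ (β : Fi ≃ₐ[F] Fi) (P Q : AlgPoints (S.M.obj Kc) (AlgebraicClosure (w.adicCompletion F))),
        (𝓜.localise w).geomReductionMap (thickeningLift e (S.M.obj Kc) P) =
          AlgPoints.map ((specialFibreFunctor w).map (Over.isoMk (θ.aut (β, 1)) (θ.aut_comp (β, 1))).hom :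
              (𝓜.localise w).reductionAt ⟶ (𝓜.localise w).reductionAt)
            ((𝓜.localise w).geomReductionMap (thickeningLift e (S.M.obj Kc) Q)) → β = 1)
    (𝔞 : (Fi ≃ₐ[F] Fi) → Ideal (𝓞 F)) (𝔫 : (Fi ≃ₐ[F] Fi) → ℕ)
    (_hdiv : ∀ (σ : Field.absoluteGaloisGroup (w.adicCompletion F)), IsAbsArithFrob σ → ∀ gam : Fi ≃ₐ[F] Fi,
        ((AlgEquiv.restrictScalars F (Field.absoluteGaloisGroup.toAlgEquiv (w.adicCompletion F) σ) :
            AlgebraicClosure (w.adicCompletion F) ≃ₐ[F] AlgebraicClosure (w.adicCompletion F)) :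
            AlgebraicClosure (w.adicCompletion F) →ₐ[F] AlgebraicClosure (w.adicCompletion F)).comp e = e.comp (gam : Fi →ₐ[F] Fi) →
        w.asIdeal ∣ 𝔞 gam)
    (_hnorm : ∀ (σ : Field.absoluteGaloisGroup (w.adicCompletion F)), IsAbsArithFrob σ → ∀ gam : Fi ≃ₐ[F] Fi,
        ((AlgEquiv.restrictScalars F (Field.absoluteGaloisGroup.toAlgEquiv (w.adicCompletion F) σ) :
            AlgebraicClosure (w.adicCompletion F) ≃ₐ[F] AlgebraicClosure (w.adicCompletion F)) :
            AlgebraicClosure (w.adicCompletion F) →ₐ[F] AlgebraicClosure (w.adicCompletion F)).comp e = e.comp (gam : Fi →ₐ[F] Fi) →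
        𝔫 gam = I.pChar ^ I.fDeg)
    (_hcov : ∀ (σ : Field.absoluteGaloisGroup (w.adicCompletion F)), IsAbsArithFrob σ → ∀ gam : Fi ≃ₐ[F] Fi,
        ((AlgEquiv.restrictScalars F (Field.absoluteGaloisGroup.toAlgEquiv (w.adicCompletion F) σ) :
            AlgebraicClosure (w.adicCompletion F) ≃ₐ[F] AlgebraicClosure (w.adicCompletion F)) :
            AlgebraicClosure (w.adicCompletion F) →ₐ[F] AlgebraicClosure (w.adicCompletion F)).comp e = e.comp (gam : Fi →ₐ[F] Fi) →
        ∀ y : AlgPoints (S.M.obj Kc) (AlgebraicClosure (w.adicCompletion F)),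
          FrobCover₀ 𝓜 w I.univ I.act I.dual I.pol I.lvl I.pChar I.fDeg (𝔞 gam) (𝔫 gam)
            (red₀Of S Kc 𝓜 w h𝓨 e (σ • y)) (red₀Of S Kc 𝓜 w h𝓨 e y))
    (_hpin : ∀ (σ : Field.absoluteGaloisGroup (w.adicCompletion F)), IsAbsArithFrob σ → ∀ gam : Fi ≃ₐ[F] Fi,
        ((AlgEquiv.restrictScalars F (Field.absoluteGaloisGroup.toAlgEquiv (w.adicCompletion F) σ) :
            AlgebraicClosure (w.adicCompletion F) ≃ₐ[F] AlgebraicClosure (w.adicCompletion F)) :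
            AlgebraicClosure (w.adicCompletion F) →ₐ[F] AlgebraicClosure (w.adicCompletion F)).comp e = e.comp (gam : Fi →ₐ[F] Fi) →
        𝔞 gam ⊔ (((IsCMField.complexConj F) • w).asIdeal : Ideal (𝓞 F)) = ⊤ ∧
          FrobKernelBanal₀ S Kc 𝓜 w h𝓨 e I.univ I.act I.pChar I.fDeg (𝔞 gam))
    (_hspec : ∀ gam : Fi ≃ₐ[F] Fi, Ideal.span {((𝔫 gam : ℕ) : 𝓞 F)} = 𝔞 gam * (IsCMField.complexConj F) • 𝔞 gam)
    ---- (F1) the CHOSEN presentation isos ARE the three-piece isos ((KE)∕(KEW) `hσΩ hσκ`; LS ED. 3: `rfl`) ----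
    (hσ : ∀ y : AlgPoints (S.M.obj Kc) (AlgebraicClosure (w.adicCompletion F)),
      (isoGenericOf I y).inv =
        (I.univ.fibreBaseChangeIso ((𝓜.localise w).genericIso'.inv.left ≫ pullback.fst (𝓜.localise w).total.hom (specGenericPoint (HeightOneSpectrum.valuationSubringAtPrime F w) F))
            (thickeningLift e (S.M.obj Kc) y).left ≪≫
          I.univ.fibreCongrPtIso (left_thickeningLift_comp_genericι_eq S Kc 𝓜 w h𝓨 e y) ≪≫
          (I.univ.fibreBaseChangeIso (liftOf S Kc 𝓜 w h𝓨 e y).left (sΩ w)).symm).inv.hom.hom.hom ∧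
      (isoSpecialOf I y).inv =
        (I.univ.fibreBaseChangeIso (pullback.fst (𝓜.localise w).total.hom (specResidueField w)) (red₀Of S Kc 𝓜 w h𝓨 e y).left ≪≫
          I.univ.fibreCongrPtIso (left_red₀Of_comp_specialι_eq S Kc 𝓜 w h𝓨 e y) ≪≫
          (I.univ.fibreBaseChangeIso (liftOf S Kc 𝓜 w h𝓨 e y).left (sκ w)).symm).inv.hom.hom.hom)
    (frobIdeal : (Fi ≃ₐ[F] Fi) → Ideal (𝓞 F))
    (hfrob : ∀ (σ : Field.absoluteGaloisGroup (w.adicCompletion F)), IsAbsArithFrob σ → ∀ gam : Fi ≃ₐ[F] Fi,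
        ((AlgEquiv.restrictScalars F (Field.absoluteGaloisGroup.toAlgEquiv (w.adicCompletion F) σ) :
            AlgebraicClosure (w.adicCompletion F) ≃ₐ[F] AlgebraicClosure (w.adicCompletion F)) :
            AlgebraicClosure (w.adicCompletion F) →ₐ[F] AlgebraicClosure (w.adicCompletion F)).comp e = e.comp (gam : Fi →ₐ[F] Fi) →
        frobIdeal gam * w.asIdeal = 𝔞 gam) :
    Quot₀RoofLaw I 𝔡 quotΩ (spGeoOf I 𝔡) frobIdeal := by
  haveI := I.comm
  haveI : IsProper (𝓜.localise w).total.hom := h𝓨.2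
  -- (i) the Serre presentation of `𝔭_w⁻¹` with scalar `p` (§I)
  have hS := exists_serrePresentation_w I
  obtain ⟨m, E', hE', P, Q, hP, hQ, hQP, hPQ, h𝔭⟩ := hS
  -- (ii) the unit pin of the datum's dual pair (§I)
  have hD := nonempty_unitHatSlice_iso_of_inputs I
  -- (iii) W1-a head′ skolemised (§A): `qbarOf`, the W5a row-holes, (FIN₀) and the per-`(y, L)` block
  have hA := exists_qbarOf_of_roofLegs I quotΩ E' hE' P Q hP hQ hQP hPQ h𝔭 hD _hroof
  obtain ⟨qbarOf, hmono, hr1, hr4q, hr5q, hr3q, hfin, hblk⟩ := hA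
  -- HEAD′ with every residual hole discharged by name (§W ∕ §D ∕ §K ∕ W1-b ∕ spine `I.hunr`)
  exact roofgeo_of_organs I 𝔡 quotΩ translΩ _hhecke _hroof _hroof₂ _hunit _hKc _hdisj 𝔞 𝔫 _hdiv _hnorm _hcov _hpin _hspec frobIdeal hfrob
    E' hE' P Q hP hQ hQP hPQ h𝔭 qbarOf hmono hr1 hr4q hr5q hr3q
    (fun xbar => F0P6aStubFROBRoofMiddleDual.exists_roofMiddleDual₀' I E' hE' P Q hP hQ hQP hPQ h𝔭 xbar)
    (holeKer_of_blk I quotΩ translΩ _hhecke _hunit _hKc _hroof _hroof₂ E' hE' qbarOf hmono hblk I.hunr) I.hunr hfin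
    (holeRkK_of_blk I quotΩ translΩ _hhecke _hunit _hKc _hroof _hroof₂ E' hE' qbarOf hmono hblk)
    (holeKill_of_blk I 𝔡 quotΩ E' hE' qbarOf hmono hblk hσ)
    (holeCLW_of_blk I quotΩ translΩ _hhecke _hunit _hKc _hroof _hroof₂ E' hE' qbarOf hmono hblk hσ)

end HeadClosed

end Summit.HodgeConjecture.HodgeConjecture.Cruxes.HLiu418.F0P6aStubFROBRoofGeoWiring

end
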